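import Summits.QuantumFields.YangMills.Theorems.AllWindowsColdBoxBoxHighLineWilsonPlaquetteTaylorCore
import Mathlib.Analysis.Complex.Trigonometric

/-!
# T-S5.7a⁽⁴⁾ `WilsonPlaquetteQuarticForm`, core: the EVEN part of the Wilson plaquette cost of four chart points to SIXTH order —
# an explicit QUARTIC FORM in the pairings `v_i·v_j` with an `O(t⁶)` remainder (ASSEMBLY-U5 §8 blocker «7a⁽⁴⁾», K3′ exact row E1)

Width seat `ym-line-sfw-p2-w3` (g42), cell ym-idea-1; planner ym-idea-2 g18 RULING 2026-08-30T01:12:48Z (E1 chain (α)): the exact Wick evaluation of the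
quartic Wilson vertex in `κ₃,₀(L̃_x, L̃_y; −βW₄)` (✓`WickPairCubic.abs_gaussAvg_centredLandauForms_mul_four_connected_le`) needs the quartic Taylor term of the
plaquette cost as an explicit polynomial; ✓T-S5.7a (`WilsonTaylor.abs_even_remainder_le`) only BOUNDS the even remainder by `42t⁴`.  This file supplies it,
for four chart points `v : Fin 4 → E3` with `‖v_i‖ ≤ t ≤ 1`:

* `cos_bound6` (`|cos r − (1 − r²/2 + r⁴/24)| ≤ (7/4320)|r|⁶`, from Mathlib's `Complex.exp_bound` at order 6), `cos_hyp`, `sinc_hyp` (`|sinc r − (1 − r²/6)| ≤ t⁴/100`);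
* scalar estimates `diag6` (the `cos`-only group), `pair6` (one `c_ic_j·(σ_kσ_l v_k·v_l)` group), `quart6` (one product of two pairings), assembled in
  ★`even6`: with `c_i = cos r_i`, `σ_i = sinc r_i`, `x_i = r_i²`, `d_kl = v_k·v_l`,
  `|2 − 2E − (Σx_i + 2d₀₁ + 2d₂₃ − 2d₀₂ − 2d₀₃ − 2d₁₂ − 2d₁₃) − Q⁴(x,d)| ≤ 20t⁶`, `E` = the even trace polynomial of ✓`WilsonTaylor.re_trace_eq`,
  `Q⁴ = −Σx_i²/12 − Σ_{i<j}x_ix_j/2 + Σ_{k<l} 2s_{kl}·d_{kl}·((x_i+x_j)/2 + (x_k+x_l)/6) − 2(d₀₁d₂₃ − d₀₂d₁₃ + d₀₃d₁₂)` (`s₀₁ = s₂₃ = −1`, the other four `+1`,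
  `{i,j}` the complement of `{k,l}`);
* the four-point statement `abs_even_remainder6_le` (`|cost(v) − (cost(v) − cost(−v))/2 − ‖v₀+v₁−v₂−v₃‖² − Q⁴(v)| ≤ 20·t⁶`), the chart-plaquette statement
  and the pair-tensor / coordinate-monomial packaging for the Wick engine are the NEXT file (`…WilsonPlaquetteQuarticForm`).
Sanity of `Q⁴`: one link `v` gives `2 − 2cos r = r² − r⁴/12 + …` ✓; `v₀ = v₁ = v` gives `2 − 2cos 2r = 4r² − (4/3)r⁴ + …` ✓; `v₀ = v₂ = v` gives `0` ✓.

Mathlib + ✓`…WilsonPlaquetteTaylorCore` only; no definitions; standard axioms.  HONEST LABEL: an M-sized Taylor brick for the K3′ exact row E1 of the UNSTAFFED stub U5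
(⟨stmt-QuantumFields-24336⟩); ⟨24004⟩ ⟨24336⟩ and this seat's crux ⟨stmt-QuantumFields-22884⟩ remain OPEN; route AllWindowsColdBox is DRAFT; no crux, rung or summit is
proved; **the Yang–Mills mass gap is NOT proved by this file; no summit is proved by a line.**
-/

set_option autoImplicit false

noncomputable section

open Matrix Finset
open Literature.MathematicalPhysics.QuantumFieldTheory.Balaban1983to89.B10Eq18SigmaSU2Haar (expPauli)

namespace Summit.QuantumFields.YangMills.Theorems.AllWindowsColdBoxBoxHighLine

namespace WilsonTaylor

/-! ## §1 One-variable Taylor bounds -/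

/-- `|cos x − (1 − x²/2 + x⁴/24)| ≤ |x|⁶·(7/4320)` for `|x| ≤ 1` (Mathlib's `Complex.exp_bound` at order `6`, real part). -/
theorem cos_bound6 {x : ℝ} (hx : |x| ≤ 1) : |Real.cos x - (1 - x ^ 2 / 2 + x ^ 4 / 24)| ≤ |x| ^ 6 * (7 / 4320) := by
  have hxI : ‖(x : ℂ) * Complex.I‖ ≤ 1 := by simpa using hx
  have hb := Complex.exp_bound hxI (show 0 < 6 by norm_num)
  have hre : (Complex.exp ((x : ℂ) * Complex.I) - ∑ m ∈ range 6, ((x : ℂ) * Complex.I) ^ m / m.factorial).re =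
      Real.cos x - (1 - x ^ 2 / 2 + x ^ 4 / 24) := by
    rw [Complex.sub_re, Complex.exp_ofReal_mul_I_re]
    simp only [Finset.sum_range_succ, Finset.sum_range_zero, Nat.factorial]
    simp [pow_succ]
    ring
  rw [← hre]
  refine (Complex.abs_re_le_norm _).trans (hb.trans ?_)
  have hn : ‖(x : ℂ) * Complex.I‖ = |x| := by simp
  rw [hn]
  norm_num [Nat.factorial]

/-- The `cos` hypothesis of `even6` for a norm `0 ≤ r ≤ t ≤ 1`: `|cos r − (1 − r²/2 + (r²)²/24)| ≤ t⁶/600`. -/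
theorem cos_hyp {r t : ℝ} (hr : 0 ≤ r) (hrt : r ≤ t) (ht1 : t ≤ 1) : |Real.cos r - (1 - r ^ 2 / 2 + (r ^ 2) ^ 2 / 24)| ≤ t ^ 6 / 600 := by
  have h := cos_bound6 (show |r| ≤ 1 by rw [abs_of_nonneg hr]; linarith)
  rw [abs_of_nonneg hr, show r ^ 4 = (r ^ 2) ^ 2 by ring] at h
  have h6 : r ^ 6 ≤ t ^ 6 := pow_le_pow_left₀ hr hrt 6
  exact h.trans (by nlinarith)

/-- The `sinc` hypothesis of `even6` for a norm `0 ≤ r ≤ t ≤ 1`: `|sinc r − (1 − r²/6)| ≤ t⁴/100` (Mathlib's fifth-order `Real.sin_bound`; the one-variable form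
`≤ r⁴/100` is the tree's ✓`Literature.MathematicalPhysics.QuantumManyBody.BoseGas.abs_sinc_sub_le`, outside this line's build closure, hence not imported). -/
theorem sinc_hyp {r t : ℝ} (hr : 0 ≤ r) (hrt : r ≤ t) (ht1 : t ≤ 1) : |Real.sinc r - (1 - r ^ 2 / 6)| ≤ t ^ 4 / 100 := by
  have h4 : r ^ 4 ≤ t ^ 4 := pow_le_pow_left₀ hr hrt 4
  rcases eq_or_lt_of_le hr with h0 | h0
  · rw [← h0]; simp; positivity
  have hb := Real.sin_bound (show |r| ≤ 1 by rw [abs_of_nonneg hr]; linarith)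
  rw [Real.sinc_of_ne_zero h0.ne', abs_of_pos h0] at *
  have hid : Real.sin r / r - (1 - r ^ 2 / 6) = (Real.sin r - (r - r ^ 3 / 6)) / r := by field_simp
  rw [hid, abs_div, abs_of_pos h0, div_le_iff₀ h0]
  calc |Real.sin r - (r - r ^ 3 / 6)| ≤ r ^ 5 / 100 := hb
    _ = r ^ 4 / 100 * r := by ring
    _ ≤ t ^ 4 / 100 * r := mul_le_mul_of_nonneg_right (by linarith) hr

/-! ## §2 Scalar estimates -/


/-- `t⁶ ≤ t⁴` on `[0,1]`. -/
theorem pow_six_le_pow_four {t : ℝ} (ht0 : 0 ≤ t) (ht1 : t ≤ 1) : t ^ 6 ≤ t ^ 4 := by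
  have h : t ^ 2 ≤ 1 := by nlinarith
  calc t ^ 6 = t ^ 4 * t ^ 2 := by ring
    _ ≤ t ^ 4 * 1 := mul_le_mul_of_nonneg_left h (pow_nonneg ht0 4)
    _ = t ^ 4 := by ring

/-- `t⁸ ≤ t⁶` on `[0,1]`. -/
theorem pow_eight_le_pow_six {t : ℝ} (ht0 : 0 ≤ t) (ht1 : t ≤ 1) : t ^ 8 ≤ t ^ 6 := by
  have h : t ^ 2 ≤ 1 := by nlinarith
  calc t ^ 8 = t ^ 6 * t ^ 2 := by ring
    _ ≤ t ^ 6 * 1 := mul_le_mul_of_nonneg_left h (pow_nonneg ht0 6)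
    _ = t ^ 6 := by ring

/-- The `β`-atom: `|α − x²/24| ≤ t⁴/20` from `|α| ≤ t⁶/600`, `0 ≤ x ≤ t²`, `t ≤ 1`. -/
theorem beta_bound {α x t : ℝ} (ht0 : 0 ≤ t) (ht1 : t ≤ 1) (hα : |α| ≤ t ^ 6 / 600) (hx : 0 ≤ x) (hxt : x ≤ t ^ 2) :
    |α - x ^ 2 / 24| ≤ t ^ 4 / 20 := by
  have hx2 : x ^ 2 ≤ t ^ 4 := by
    calc x ^ 2 ≤ (t ^ 2) ^ 2 := pow_le_pow_left₀ hx hxt 2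
      _ = t ^ 4 := by ring
  have h1 : |α - x ^ 2 / 24| ≤ t ^ 6 / 600 + t ^ 4 / 24 := by
    refine (abs_sub _ _).trans (add_le_add hα ?_)
    rw [abs_of_nonneg (by positivity)]
    exact div_le_div_of_nonneg_right hx2 (by norm_num)
  have h2 := pow_six_le_pow_four ht0 ht1
  have h3 := pow_nonneg ht0 4
  linarith

/-- A pair piece: `|β·u + x·β'/2| ≤ t⁶/20`. -/
theorem pair_piece_bound {β u x β' t : ℝ} (hβ : |β| ≤ t ^ 4 / 20) (hu0 : 0 ≤ u) (hu1 : u ≤ t ^ 2 / 2)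
    (hx0 : 0 ≤ x) (hx1 : x ≤ t ^ 2) (hβ' : |β'| ≤ t ^ 4 / 20) : |β * u + x * β' / 2| ≤ t ^ 6 / 20 := by
  have h1 : |β * u| ≤ t ^ 4 / 20 * (t ^ 2 / 2) := by
    rw [abs_mul, abs_of_nonneg hu0]; exact mul_le_mul hβ hu1 hu0 (by positivity)
  have h2 : |x * β' / 2| ≤ t ^ 2 * (t ^ 4 / 20) / 2 := by
    rw [abs_div, abs_mul, abs_of_nonneg hx0, abs_two]
    exact div_le_div_of_nonneg_right (mul_le_mul hx1 hβ' (abs_nonneg _) (by positivity)) (by norm_num)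
  calc |β * u + x * β' / 2| ≤ |β * u| + |x * β' / 2| := abs_add_le _ _
    _ ≤ t ^ 4 / 20 * (t ^ 2 / 2) + t ^ 2 * (t ^ 4 / 20) / 2 := add_le_add h1 h2
    _ = t ^ 6 / 20 := by ring

/-- A triple product of numbers in `[0, t²/2]` is `≤ t⁶/8`. -/
theorem triple_bound {a b c t : ℝ} (hb : 0 ≤ b) (hc : 0 ≤ c) (ha1 : a ≤ t ^ 2 / 2) (hb1 : b ≤ t ^ 2 / 2)
    (hc1 : c ≤ t ^ 2 / 2) : a * b * c ≤ t ^ 6 / 8 := by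
  calc a * b * c ≤ t ^ 2 / 2 * (t ^ 2 / 2) * (t ^ 2 / 2) :=
        mul_le_mul (mul_le_mul ha1 hb1 hb (by positivity)) hc1 hc (by positivity)
    _ = t ^ 6 / 8 := by ring

/-- Group D (the `cos`-only part): `|2 − 2c₁c₂c₃c₄ − Σx + Σx²/12 + Σ_{i<j}x_ix_j/2| ≤ 2t⁶`. -/
theorem diag6 {c₁ c₂ c₃ c₄ x₁ x₂ x₃ x₄ t : ℝ} (ht0 : 0 ≤ t) (ht1 : t ≤ 1)
    (hx₁ : 0 ≤ x₁) (hx₂ : 0 ≤ x₂) (hx₃ : 0 ≤ x₃) (hx₄ : 0 ≤ x₄)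
    (hx₁t : x₁ ≤ t ^ 2) (hx₂t : x₂ ≤ t ^ 2) (hx₃t : x₃ ≤ t ^ 2) (hx₄t : x₄ ≤ t ^ 2)
    (hc₁ : 1 - x₁ / 2 ≤ c₁) (hc₂ : 1 - x₂ / 2 ≤ c₂) (hc₃ : 1 - x₃ / 2 ≤ c₃) (hc₄ : 1 - x₄ / 2 ≤ c₄)
    (hc₁1 : c₁ ≤ 1) (hc₂1 : c₂ ≤ 1) (hc₃1 : c₃ ≤ 1) (hc₄1 : c₄ ≤ 1)
    (he₁ : |c₁ - (1 - x₁ / 2 + x₁ ^ 2 / 24)| ≤ t ^ 6 / 600) (he₂ : |c₂ - (1 - x₂ / 2 + x₂ ^ 2 / 24)| ≤ t ^ 6 / 600)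
    (he₃ : |c₃ - (1 - x₃ / 2 + x₃ ^ 2 / 24)| ≤ t ^ 6 / 600) (he₄ : |c₄ - (1 - x₄ / 2 + x₄ ^ 2 / 24)| ≤ t ^ 6 / 600) :
    |2 - 2 * (c₁ * c₂ * c₃ * c₄) - (x₁ + x₂ + x₃ + x₄) + (x₁ ^ 2 + x₂ ^ 2 + x₃ ^ 2 + x₄ ^ 2) / 12
      + (x₁ * x₂ + x₁ * x₃ + x₁ * x₄ + x₂ * x₃ + x₂ * x₄ + x₃ * x₄) / 2| ≤ 2 * t ^ 6 := by
  have ht8 := pow_eight_le_pow_six ht0 ht1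
  have u₁0 : 0 ≤ 1 - c₁ := by linarith
  have u₂0 : 0 ≤ 1 - c₂ := by linarith
  have u₃0 : 0 ≤ 1 - c₃ := by linarith
  have u₄0 : 0 ≤ 1 - c₄ := by linarith
  have u₁1 : 1 - c₁ ≤ t ^ 2 / 2 := by linarith
  have u₂1 : 1 - c₂ ≤ t ^ 2 / 2 := by linarith
  have u₃1 : 1 - c₃ ≤ t ^ 2 / 2 := by linarith
  have u₄1 : 1 - c₄ ≤ t ^ 2 / 2 := by linarith
  have a₁ : |1 - c₁ - x₁ / 2 + x₁ ^ 2 / 24| ≤ t ^ 6 / 600 := by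
    rw [show 1 - c₁ - x₁ / 2 + x₁ ^ 2 / 24 = -(c₁ - (1 - x₁ / 2 + x₁ ^ 2 / 24)) by ring, abs_neg]; exact he₁
  have a₂ : |1 - c₂ - x₂ / 2 + x₂ ^ 2 / 24| ≤ t ^ 6 / 600 := by
    rw [show 1 - c₂ - x₂ / 2 + x₂ ^ 2 / 24 = -(c₂ - (1 - x₂ / 2 + x₂ ^ 2 / 24)) by ring, abs_neg]; exact he₂
  have a₃ : |1 - c₃ - x₃ / 2 + x₃ ^ 2 / 24| ≤ t ^ 6 / 600 := by
    rw [show 1 - c₃ - x₃ / 2 + x₃ ^ 2 / 24 = -(c₃ - (1 - x₃ / 2 + x₃ ^ 2 / 24)) by ring, abs_neg]; exact he₃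
  have a₄ : |1 - c₄ - x₄ / 2 + x₄ ^ 2 / 24| ≤ t ^ 6 / 600 := by
    rw [show 1 - c₄ - x₄ / 2 + x₄ ^ 2 / 24 = -(c₄ - (1 - x₄ / 2 + x₄ ^ 2 / 24)) by ring, abs_neg]; exact he₄
  have b₁ := beta_bound ht0 ht1 a₁ hx₁ hx₁t
  have b₂ := beta_bound ht0 ht1 a₂ hx₂ hx₂t
  have b₃ := beta_bound ht0 ht1 a₃ hx₃ hx₃t
  have b₄ := beta_bound ht0 ht1 a₄ hx₄ hx₄t
  have p₁₂ := pair_piece_bound b₁ u₂0 u₂1 hx₁ hx₁t b₂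
  have p₁₃ := pair_piece_bound b₁ u₃0 u₃1 hx₁ hx₁t b₃
  have p₁₄ := pair_piece_bound b₁ u₄0 u₄1 hx₁ hx₁t b₄
  have p₂₃ := pair_piece_bound b₂ u₃0 u₃1 hx₂ hx₂t b₃
  have p₂₄ := pair_piece_bound b₂ u₄0 u₄1 hx₂ hx₂t b₄
  have p₃₄ := pair_piece_bound b₃ u₄0 u₄1 hx₃ hx₃t b₄
  have q₁ := triple_bound u₂0 u₃0 u₁1 u₂1 u₃1
  have q₂ := triple_bound u₂0 u₄0 u₁1 u₂1 u₄1
  have q₃ := triple_bound u₃0 u₄0 u₁1 u₃1 u₄1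
  have q₄ := triple_bound u₃0 u₄0 u₂1 u₃1 u₄1
  have q₁0 : 0 ≤ (1 - c₁) * (1 - c₂) * (1 - c₃) := by positivity
  have q₂0 : 0 ≤ (1 - c₁) * (1 - c₂) * (1 - c₄) := by positivity
  have q₃0 : 0 ≤ (1 - c₁) * (1 - c₃) * (1 - c₄) := by positivity
  have q₄0 : 0 ≤ (1 - c₂) * (1 - c₃) * (1 - c₄) := by positivity
  have q0 : 0 ≤ (1 - c₁) * (1 - c₂) * (1 - c₃) * (1 - c₄) := by positivity
  have q5 : (1 - c₁) * (1 - c₂) * (1 - c₃) * (1 - c₄) ≤ t ^ 6 / 8 * (t ^ 2 / 2) := mul_le_mul q₁ u₄1 u₄0 (by positivity)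
  have q6 : (1 - c₁) * (1 - c₂) * (1 - c₃) * (1 - c₄) ≤ t ^ 6 / 16 := by
    have : t ^ 6 / 8 * (t ^ 2 / 2) = t ^ 8 / 16 := by ring
    rw [this] at q5; linarith
  -- the identity
  have hid : 2 - 2 * (c₁ * c₂ * c₃ * c₄) - (x₁ + x₂ + x₃ + x₄) + (x₁ ^ 2 + x₂ ^ 2 + x₃ ^ 2 + x₄ ^ 2) / 12
      + (x₁ * x₂ + x₁ * x₃ + x₁ * x₄ + x₂ * x₃ + x₂ * x₄ + x₃ * x₄) / 2 =
      2 * ((1 - c₁ - x₁ / 2 + x₁ ^ 2 / 24) + (1 - c₂ - x₂ / 2 + x₂ ^ 2 / 24) + (1 - c₃ - x₃ / 2 + x₃ ^ 2 / 24)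
        + (1 - c₄ - x₄ / 2 + x₄ ^ 2 / 24))
      - 2 * (((1 - c₁ - x₁ / 2 + x₁ ^ 2 / 24 - x₁ ^ 2 / 24) * (1 - c₂) + x₁ * (1 - c₂ - x₂ / 2 + x₂ ^ 2 / 24 - x₂ ^ 2 / 24) / 2)
          + ((1 - c₁ - x₁ / 2 + x₁ ^ 2 / 24 - x₁ ^ 2 / 24) * (1 - c₃) + x₁ * (1 - c₃ - x₃ / 2 + x₃ ^ 2 / 24 - x₃ ^ 2 / 24) / 2)
          + ((1 - c₁ - x₁ / 2 + x₁ ^ 2 / 24 - x₁ ^ 2 / 24) * (1 - c₄) + x₁ * (1 - c₄ - x₄ / 2 + x₄ ^ 2 / 24 - x₄ ^ 2 / 24) / 2)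
          + ((1 - c₂ - x₂ / 2 + x₂ ^ 2 / 24 - x₂ ^ 2 / 24) * (1 - c₃) + x₂ * (1 - c₃ - x₃ / 2 + x₃ ^ 2 / 24 - x₃ ^ 2 / 24) / 2)
          + ((1 - c₂ - x₂ / 2 + x₂ ^ 2 / 24 - x₂ ^ 2 / 24) * (1 - c₄) + x₂ * (1 - c₄ - x₄ / 2 + x₄ ^ 2 / 24 - x₄ ^ 2 / 24) / 2)
          + ((1 - c₃ - x₃ / 2 + x₃ ^ 2 / 24 - x₃ ^ 2 / 24) * (1 - c₄) + x₃ * (1 - c₄ - x₄ / 2 + x₄ ^ 2 / 24 - x₄ ^ 2 / 24) / 2))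
      + 2 * ((1 - c₁) * (1 - c₂) * (1 - c₃) + (1 - c₁) * (1 - c₂) * (1 - c₄) + (1 - c₁) * (1 - c₃) * (1 - c₄)
          + (1 - c₂) * (1 - c₃) * (1 - c₄))
      - 2 * ((1 - c₁) * (1 - c₂) * (1 - c₃) * (1 - c₄)) := by
    ring
  rw [hid, abs_le]
  constructor
  · linarith [(abs_le.1 a₁).1, (abs_le.1 a₂).1, (abs_le.1 a₃).1, (abs_le.1 a₄).1, (abs_le.1 p₁₂).2, (abs_le.1 p₁₃).2, (abs_le.1 p₁₄).2,
      (abs_le.1 p₂₃).2, (abs_le.1 p₂₄).2, (abs_le.1 p₃₄).2]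
  · linarith [(abs_le.1 a₁).2, (abs_le.1 a₂).2, (abs_le.1 a₃).2, (abs_le.1 a₄).2, (abs_le.1 p₁₂).1, (abs_le.1 p₁₃).1, (abs_le.1 p₁₄).1,
      (abs_le.1 p₂₃).1, (abs_le.1 p₂₄).1, (abs_le.1 p₃₄).1]


/-- `|σσ' − 1| ≤ 2t²/5` for `sinc`-type factors `σ = 1 − x/6 + f`, `|f| ≤ t⁴/100`, `0 ≤ x ≤ t² ≤ 1`. -/
theorem sinc_prod_sub_one_le {σ σ' x x' t : ℝ} (ht0 : 0 ≤ t) (ht1 : t ≤ 1) (hx : 0 ≤ x) (hx' : 0 ≤ x') (hxt : x ≤ t ^ 2)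
    (hxt' : x' ≤ t ^ 2) (hσ : |σ - (1 - x / 6)| ≤ t ^ 4 / 100) (hσ' : |σ' - (1 - x' / 6)| ≤ t ^ 4 / 100) :
    |σ * σ' - 1 + x / 6 + x' / 6| ≤ t ^ 4 / 16 ∧ |σ * σ' - 1| ≤ 2 * t ^ 2 / 5 := by
  have h4 := pow_six_le_pow_four ht0 ht1
  have ht4 : 0 ≤ t ^ 4 := pow_nonneg ht0 4
  have ht2 : t ^ 2 ≤ 1 := by nlinarith
  set f := σ - (1 - x / 6) with hf
  set f' := σ' - (1 - x' / 6) with hf'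
  have hid : σ * σ' - 1 + x / 6 + x' / 6 = f * (1 - x' / 6) + f' * (1 - x / 6) + f * f' + x * x' / 36 := by
    simp only [hf, hf']; ring
  have h1 : |f * (1 - x' / 6)| ≤ t ^ 4 / 100 * 1 := by
    rw [abs_mul]; refine mul_le_mul hσ ?_ (abs_nonneg _) (by positivity)
    rw [abs_le]; constructor <;> nlinarith
  have h2 : |f' * (1 - x / 6)| ≤ t ^ 4 / 100 * 1 := by
    rw [abs_mul]; refine mul_le_mul hσ' ?_ (abs_nonneg _) (by positivity)
    rw [abs_le]; constructor <;> nlinarith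
  have h3 : |f * f'| ≤ t ^ 4 / 100 * (t ^ 4 / 100) := by
    rw [abs_mul]; exact mul_le_mul hσ hσ' (abs_nonneg _) (by positivity)
  have h5 : |x * x' / 36| ≤ t ^ 2 * t ^ 2 / 36 := by
    rw [abs_of_nonneg (by positivity)]; exact div_le_div_of_nonneg_right (mul_le_mul hxt hxt' hx' (by positivity)) (by norm_num)
  have hA : |σ * σ' - 1 + x / 6 + x' / 6| ≤ t ^ 4 / 16 := by
    rw [hid]
    have := abs_add_le (f * (1 - x' / 6) + f' * (1 - x / 6) + f * f') (x * x' / 36)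
    have := abs_add_le (f * (1 - x' / 6) + f' * (1 - x / 6)) (f * f')
    have := abs_add_le (f * (1 - x' / 6)) (f' * (1 - x / 6))
    nlinarith
  refine ⟨hA, ?_⟩
  have : σ * σ' - 1 = (σ * σ' - 1 + x / 6 + x' / 6) - (x / 6 + x' / 6) := by ring
  rw [this]
  refine (abs_sub _ _).trans ?_
  rw [abs_of_nonneg (by positivity : 0 ≤ x / 6 + x' / 6)]
  nlinarith

/-- Group P, one pair: `|c_ic_j·(σ_kσ_l·d) − d + d·((x_i+x_j)/2 + (x_k+x_l)/6)| ≤ t⁶`. -/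
theorem pair6 {ci cj σk σl xi xj xk xl d t : ℝ} (ht0 : 0 ≤ t) (ht1 : t ≤ 1)
    (hxi : 0 ≤ xi) (hxj : 0 ≤ xj) (hxk : 0 ≤ xk) (hxl : 0 ≤ xl)
    (hxit : xi ≤ t ^ 2) (hxjt : xj ≤ t ^ 2) (hxkt : xk ≤ t ^ 2) (hxlt : xl ≤ t ^ 2)
    (hci : 1 - xi / 2 ≤ ci) (hcj : 1 - xj / 2 ≤ cj) (hci1 : ci ≤ 1) (hcj1 : cj ≤ 1)
    (hei : |ci - (1 - xi / 2 + xi ^ 2 / 24)| ≤ t ^ 6 / 600) (hej : |cj - (1 - xj / 2 + xj ^ 2 / 24)| ≤ t ^ 6 / 600)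
    (hσk : |σk - (1 - xk / 6)| ≤ t ^ 4 / 100) (hσl : |σl - (1 - xl / 6)| ≤ t ^ 4 / 100) (hd : |d| ≤ t ^ 2) :
    |ci * cj * (σk * σl * d) - d + d * ((xi + xj) / 2 + (xk + xl) / 6)| ≤ t ^ 6 := by
  have ht4 : 0 ≤ t ^ 4 := pow_nonneg ht0 4
  have ht2 : t ^ 2 ≤ 1 := by nlinarith
  -- atoms
  have ui0 : 0 ≤ 1 - ci := by linarith
  have uj0 : 0 ≤ 1 - cj := by linarith
  have ui1 : 1 - ci ≤ t ^ 2 / 2 := by linarith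
  have uj1 : 1 - cj ≤ t ^ 2 / 2 := by linarith
  have ai : |1 - ci - xi / 2 + xi ^ 2 / 24| ≤ t ^ 6 / 600 := by
    rw [show 1 - ci - xi / 2 + xi ^ 2 / 24 = -(ci - (1 - xi / 2 + xi ^ 2 / 24)) by ring, abs_neg]; exact hei
  have aj : |1 - cj - xj / 2 + xj ^ 2 / 24| ≤ t ^ 6 / 600 := by
    rw [show 1 - cj - xj / 2 + xj ^ 2 / 24 = -(cj - (1 - xj / 2 + xj ^ 2 / 24)) by ring, abs_neg]; exact hej
  have bi := beta_bound ht0 ht1 ai hxi hxit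
  have bj := beta_bound ht0 ht1 aj hxj hxjt
  obtain ⟨gB, hB1⟩ := sinc_prod_sub_one_le ht0 ht1 hxk hxl hxkt hxlt hσk hσl
  -- |A − 1| ≤ 5t²/4 with A = c_ic_j
  have hA1 : |ci * cj - 1| ≤ 5 * t ^ 2 / 4 := by
    have : ci * cj - 1 = -(1 - ci) - (1 - cj) + (1 - ci) * (1 - cj) := by ring
    rw [this, abs_le]; constructor <;> nlinarith [mul_nonneg ui0 uj0, mul_le_mul ui1 uj1 uj0 (by positivity : (0:ℝ) ≤ t ^ 2 / 2)]
  -- the identity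
  have hid : ci * cj * (σk * σl * d) - d + d * ((xi + xj) / 2 + (xk + xl) / 6) =
      d * (-(1 - ci - xi / 2 + xi ^ 2 / 24 - xi ^ 2 / 24) - (1 - cj - xj / 2 + xj ^ 2 / 24 - xj ^ 2 / 24) + (1 - ci) * (1 - cj)
        + (σk * σl - 1 + xk / 6 + xl / 6) + (ci * cj - 1) * (σk * σl - 1)) := by ring
  have hin : |-(1 - ci - xi / 2 + xi ^ 2 / 24 - xi ^ 2 / 24) - (1 - cj - xj / 2 + xj ^ 2 / 24 - xj ^ 2 / 24) + (1 - ci) * (1 - cj)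
        + (σk * σl - 1 + xk / 6 + xl / 6) + (ci * cj - 1) * (σk * σl - 1)| ≤ t ^ 4 := by
    have hprod : |(ci * cj - 1) * (σk * σl - 1)| ≤ 5 * t ^ 2 / 4 * (2 * t ^ 2 / 5) := by
      rw [abs_mul]; exact mul_le_mul hA1 hB1 (abs_nonneg _) (by positivity)
    have huu : |(1 - ci) * (1 - cj)| ≤ t ^ 2 / 2 * (t ^ 2 / 2) := by
      rw [abs_mul, abs_of_nonneg ui0, abs_of_nonneg uj0]; exact mul_le_mul ui1 uj1 uj0 (by positivity)
    have e1 := abs_add_le (-(1 - ci - xi / 2 + xi ^ 2 / 24 - xi ^ 2 / 24) - (1 - cj - xj / 2 + xj ^ 2 / 24 - xj ^ 2 / 24) + (1 - ci) * (1 - cj)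
        + (σk * σl - 1 + xk / 6 + xl / 6)) ((ci * cj - 1) * (σk * σl - 1))
    have e2 := abs_add_le (-(1 - ci - xi / 2 + xi ^ 2 / 24 - xi ^ 2 / 24) - (1 - cj - xj / 2 + xj ^ 2 / 24 - xj ^ 2 / 24) + (1 - ci) * (1 - cj))
        (σk * σl - 1 + xk / 6 + xl / 6)
    have e3 := abs_add_le (-(1 - ci - xi / 2 + xi ^ 2 / 24 - xi ^ 2 / 24) - (1 - cj - xj / 2 + xj ^ 2 / 24 - xj ^ 2 / 24)) ((1 - ci) * (1 - cj))
    have e4 := abs_sub (-(1 - ci - xi / 2 + xi ^ 2 / 24 - xi ^ 2 / 24)) (1 - cj - xj / 2 + xj ^ 2 / 24 - xj ^ 2 / 24)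
    rw [abs_neg] at e4
    nlinarith
  rw [hid, abs_mul]
  calc |d| * _ ≤ t ^ 2 * t ^ 4 := mul_le_mul hd hin (abs_nonneg _) (by positivity)
    _ = t ^ 6 := by ring

/-- Group Q, one product: `|(σ_kσ_l d)(σ_mσ_n d') − d·d'| ≤ t⁶`. -/
theorem quart6 {σk σl σm σn xk xl xm xn d d' t : ℝ} (ht0 : 0 ≤ t) (ht1 : t ≤ 1)
    (hxk : 0 ≤ xk) (hxl : 0 ≤ xl) (hxm : 0 ≤ xm) (hxn : 0 ≤ xn)
    (hxkt : xk ≤ t ^ 2) (hxlt : xl ≤ t ^ 2) (hxmt : xm ≤ t ^ 2) (hxnt : xn ≤ t ^ 2)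
    (hσk : |σk - (1 - xk / 6)| ≤ t ^ 4 / 100) (hσl : |σl - (1 - xl / 6)| ≤ t ^ 4 / 100)
    (hσm : |σm - (1 - xm / 6)| ≤ t ^ 4 / 100) (hσn : |σn - (1 - xn / 6)| ≤ t ^ 4 / 100)
    (hσm1 : |σm| ≤ 1) (hσn1 : |σn| ≤ 1) (hd : |d| ≤ t ^ 2) (hd' : |d'| ≤ t ^ 2) :
    |σk * σl * d * (σm * σn * d') - d * d'| ≤ t ^ 6 := by
  have ht4 : 0 ≤ t ^ 4 := pow_nonneg ht0 4
  obtain ⟨-, h1⟩ := sinc_prod_sub_one_le ht0 ht1 hxk hxl hxkt hxlt hσk hσl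
  obtain ⟨-, h2⟩ := sinc_prod_sub_one_le ht0 ht1 hxm hxn hxmt hxnt hσm hσn
  have hid : σk * σl * d * (σm * σn * d') - d * d' = (σk * σl - 1) * d * (σm * σn * d') + d * ((σm * σn - 1) * d') := by ring
  rw [hid]
  have hP' : |σm * σn * d'| ≤ 1 * 1 * t ^ 2 := by
    rw [abs_mul, abs_mul]; exact mul_le_mul (mul_le_mul hσm1 hσn1 (abs_nonneg _) zero_le_one) hd' (abs_nonneg _) (by positivity)
  have hA : |(σk * σl - 1) * d * (σm * σn * d')| ≤ 2 * t ^ 2 / 5 * t ^ 2 * (1 * 1 * t ^ 2) := by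
    rw [abs_mul, abs_mul]
    exact mul_le_mul (mul_le_mul h1 hd (abs_nonneg _) (by positivity)) hP' (abs_nonneg _) (by positivity)
  have hB : |d * ((σm * σn - 1) * d')| ≤ t ^ 2 * (2 * t ^ 2 / 5 * t ^ 2) := by
    rw [abs_mul, abs_mul]
    exact mul_le_mul hd (mul_le_mul h2 hd' (abs_nonneg _) (by positivity)) (by positivity) (by positivity)
  calc _ ≤ |(σk * σl - 1) * d * (σm * σn * d')| + |d * ((σm * σn - 1) * d')| := abs_add_le _ _
    _ ≤ 2 * t ^ 2 / 5 * t ^ 2 * (1 * 1 * t ^ 2) + t ^ 2 * (2 * t ^ 2 / 5 * t ^ 2) := add_le_add hA hB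
    _ = 4 / 5 * t ^ 6 := by ring
    _ ≤ t ^ 6 := by nlinarith [pow_nonneg ht0 6]


/-- ★ **The sixth-order even remainder, scalar form.**  With `c_i = cos r_i`, `σ_i = sinc r_i`, `x_i = r_i²`, `d_kl = v_k·v_l` (`r_i ≤ t ≤ 1`):
`|2 − 2E − ‖v₀+v₁−v₂−v₃‖² − Q⁴| ≤ 20t⁶`, where `E` is the even trace polynomial of ✓`WilsonTaylor.re_trace_eq` and `Q⁴` the explicit quartic form. -/
theorem even6 {c₀ c₁ c₂ c₃ σ₀ σ₁ σ₂ σ₃ x₀ x₁ x₂ x₃ d₀₁ d₀₂ d₀₃ d₁₂ d₁₃ d₂₃ t : ℝ} (ht0 : 0 ≤ t) (ht1 : t ≤ 1)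
    (hx₀ : 0 ≤ x₀) (hx₁ : 0 ≤ x₁) (hx₂ : 0 ≤ x₂) (hx₃ : 0 ≤ x₃)
    (hx₀t : x₀ ≤ t ^ 2) (hx₁t : x₁ ≤ t ^ 2) (hx₂t : x₂ ≤ t ^ 2) (hx₃t : x₃ ≤ t ^ 2)
    (hc₀ : 1 - x₀ / 2 ≤ c₀) (hc₁ : 1 - x₁ / 2 ≤ c₁) (hc₂ : 1 - x₂ / 2 ≤ c₂) (hc₃ : 1 - x₃ / 2 ≤ c₃)
    (hc₀1 : c₀ ≤ 1) (hc₁1 : c₁ ≤ 1) (hc₂1 : c₂ ≤ 1) (hc₃1 : c₃ ≤ 1)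
    (he₀ : |c₀ - (1 - x₀ / 2 + x₀ ^ 2 / 24)| ≤ t ^ 6 / 600) (he₁ : |c₁ - (1 - x₁ / 2 + x₁ ^ 2 / 24)| ≤ t ^ 6 / 600)
    (he₂ : |c₂ - (1 - x₂ / 2 + x₂ ^ 2 / 24)| ≤ t ^ 6 / 600) (he₃ : |c₃ - (1 - x₃ / 2 + x₃ ^ 2 / 24)| ≤ t ^ 6 / 600)
    (hσ₀ : |σ₀ - (1 - x₀ / 6)| ≤ t ^ 4 / 100) (hσ₁ : |σ₁ - (1 - x₁ / 6)| ≤ t ^ 4 / 100)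
    (hσ₂ : |σ₂ - (1 - x₂ / 6)| ≤ t ^ 4 / 100) (hσ₃ : |σ₃ - (1 - x₃ / 6)| ≤ t ^ 4 / 100)
    (hσ₁1 : |σ₁| ≤ 1) (hσ₂1 : |σ₂| ≤ 1) (hσ₃1 : |σ₃| ≤ 1)
    (hd₀₁ : |d₀₁| ≤ t ^ 2) (hd₀₂ : |d₀₂| ≤ t ^ 2) (hd₀₃ : |d₀₃| ≤ t ^ 2) (hd₁₂ : |d₁₂| ≤ t ^ 2) (hd₁₃ : |d₁₃| ≤ t ^ 2)
    (hd₂₃ : |d₂₃| ≤ t ^ 2) :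
    |2 - 2 * (c₀ * c₁ * c₂ * c₃ - c₀ * c₁ * (σ₂ * σ₃ * d₂₃) - c₂ * c₃ * (σ₀ * σ₁ * d₀₁) + c₀ * c₂ * (σ₁ * σ₃ * d₁₃)
          + c₀ * c₃ * (σ₁ * σ₂ * d₁₂) + c₁ * c₂ * (σ₀ * σ₃ * d₀₃) + c₁ * c₃ * (σ₀ * σ₂ * d₀₂)
          + (σ₀ * σ₁ * d₀₁) * (σ₂ * σ₃ * d₂₃) - (σ₀ * σ₂ * d₀₂) * (σ₁ * σ₃ * d₁₃) + (σ₀ * σ₃ * d₀₃) * (σ₁ * σ₂ * d₁₂))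
      - (x₀ + x₁ + x₂ + x₃ + 2 * d₀₁ + 2 * d₂₃ - 2 * d₀₂ - 2 * d₀₃ - 2 * d₁₂ - 2 * d₁₃)
      - (-(x₀ ^ 2 + x₁ ^ 2 + x₂ ^ 2 + x₃ ^ 2) / 12 - (x₀ * x₁ + x₀ * x₂ + x₀ * x₃ + x₁ * x₂ + x₁ * x₃ + x₂ * x₃) / 2
          - 2 * d₀₁ * ((x₂ + x₃) / 2 + (x₀ + x₁) / 6) - 2 * d₂₃ * ((x₀ + x₁) / 2 + (x₂ + x₃) / 6)
          + 2 * d₀₂ * ((x₁ + x₃) / 2 + (x₀ + x₂) / 6) + 2 * d₀₃ * ((x₁ + x₂) / 2 + (x₀ + x₃) / 6)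
          + 2 * d₁₂ * ((x₀ + x₃) / 2 + (x₁ + x₂) / 6) + 2 * d₁₃ * ((x₀ + x₂) / 2 + (x₁ + x₃) / 6)
          - 2 * (d₀₁ * d₂₃ - d₀₂ * d₁₃ + d₀₃ * d₁₂))| ≤ 20 * t ^ 6 := by
  have hD := diag6 ht0 ht1 hx₀ hx₁ hx₂ hx₃ hx₀t hx₁t hx₂t hx₃t hc₀ hc₁ hc₂ hc₃ hc₀1 hc₁1 hc₂1 hc₃1 he₀ he₁ he₂ he₃
  have P01 := pair6 ht0 ht1 hx₂ hx₃ hx₀ hx₁ hx₂t hx₃t hx₀t hx₁t hc₂ hc₃ hc₂1 hc₃1 he₂ he₃ hσ₀ hσ₁ hd₀₁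
  have P23 := pair6 ht0 ht1 hx₀ hx₁ hx₂ hx₃ hx₀t hx₁t hx₂t hx₃t hc₀ hc₁ hc₀1 hc₁1 he₀ he₁ hσ₂ hσ₃ hd₂₃
  have P02 := pair6 ht0 ht1 hx₁ hx₃ hx₀ hx₂ hx₁t hx₃t hx₀t hx₂t hc₁ hc₃ hc₁1 hc₃1 he₁ he₃ hσ₀ hσ₂ hd₀₂
  have P03 := pair6 ht0 ht1 hx₁ hx₂ hx₀ hx₃ hx₁t hx₂t hx₀t hx₃t hc₁ hc₂ hc₁1 hc₂1 he₁ he₂ hσ₀ hσ₃ hd₀₃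
  have P12 := pair6 ht0 ht1 hx₀ hx₃ hx₁ hx₂ hx₀t hx₃t hx₁t hx₂t hc₀ hc₃ hc₀1 hc₃1 he₀ he₃ hσ₁ hσ₂ hd₁₂
  have P13 := pair6 ht0 ht1 hx₀ hx₂ hx₁ hx₃ hx₀t hx₂t hx₁t hx₃t hc₀ hc₂ hc₀1 hc₂1 he₀ he₂ hσ₁ hσ₃ hd₁₃
  have Q1 := quart6 ht0 ht1 hx₀ hx₁ hx₂ hx₃ hx₀t hx₁t hx₂t hx₃t hσ₀ hσ₁ hσ₂ hσ₃ hσ₂1 hσ₃1 hd₀₁ hd₂₃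
  have Q2 := quart6 ht0 ht1 hx₀ hx₂ hx₁ hx₃ hx₀t hx₂t hx₁t hx₃t hσ₀ hσ₂ hσ₁ hσ₃ hσ₁1 hσ₃1 hd₀₂ hd₁₃
  have Q3 := quart6 ht0 ht1 hx₀ hx₃ hx₁ hx₂ hx₀t hx₃t hx₁t hx₂t hσ₀ hσ₃ hσ₁ hσ₂ hσ₁1 hσ₂1 hd₀₃ hd₁₂
  have hid : 2 - 2 * (c₀ * c₁ * c₂ * c₃ - c₀ * c₁ * (σ₂ * σ₃ * d₂₃) - c₂ * c₃ * (σ₀ * σ₁ * d₀₁) + c₀ * c₂ * (σ₁ * σ₃ * d₁₃)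
          + c₀ * c₃ * (σ₁ * σ₂ * d₁₂) + c₁ * c₂ * (σ₀ * σ₃ * d₀₃) + c₁ * c₃ * (σ₀ * σ₂ * d₀₂)
          + (σ₀ * σ₁ * d₀₁) * (σ₂ * σ₃ * d₂₃) - (σ₀ * σ₂ * d₀₂) * (σ₁ * σ₃ * d₁₃) + (σ₀ * σ₃ * d₀₃) * (σ₁ * σ₂ * d₁₂))
      - (x₀ + x₁ + x₂ + x₃ + 2 * d₀₁ + 2 * d₂₃ - 2 * d₀₂ - 2 * d₀₃ - 2 * d₁₂ - 2 * d₁₃)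
      - (-(x₀ ^ 2 + x₁ ^ 2 + x₂ ^ 2 + x₃ ^ 2) / 12 - (x₀ * x₁ + x₀ * x₂ + x₀ * x₃ + x₁ * x₂ + x₁ * x₃ + x₂ * x₃) / 2
          - 2 * d₀₁ * ((x₂ + x₃) / 2 + (x₀ + x₁) / 6) - 2 * d₂₃ * ((x₀ + x₁) / 2 + (x₂ + x₃) / 6)
          + 2 * d₀₂ * ((x₁ + x₃) / 2 + (x₀ + x₂) / 6) + 2 * d₀₃ * ((x₁ + x₂) / 2 + (x₀ + x₃) / 6)
          + 2 * d₁₂ * ((x₀ + x₃) / 2 + (x₁ + x₂) / 6) + 2 * d₁₃ * ((x₀ + x₂) / 2 + (x₁ + x₃) / 6)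
          - 2 * (d₀₁ * d₂₃ - d₀₂ * d₁₃ + d₀₃ * d₁₂)) =
      (2 - 2 * (c₀ * c₁ * c₂ * c₃) - (x₀ + x₁ + x₂ + x₃) + (x₀ ^ 2 + x₁ ^ 2 + x₂ ^ 2 + x₃ ^ 2) / 12
          + (x₀ * x₁ + x₀ * x₂ + x₀ * x₃ + x₁ * x₂ + x₁ * x₃ + x₂ * x₃) / 2)
      + 2 * (c₂ * c₃ * (σ₀ * σ₁ * d₀₁) - d₀₁ + d₀₁ * ((x₂ + x₃) / 2 + (x₀ + x₁) / 6))
      + 2 * (c₀ * c₁ * (σ₂ * σ₃ * d₂₃) - d₂₃ + d₂₃ * ((x₀ + x₁) / 2 + (x₂ + x₃) / 6))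
      - 2 * (c₁ * c₃ * (σ₀ * σ₂ * d₀₂) - d₀₂ + d₀₂ * ((x₁ + x₃) / 2 + (x₀ + x₂) / 6))
      - 2 * (c₁ * c₂ * (σ₀ * σ₃ * d₀₃) - d₀₃ + d₀₃ * ((x₁ + x₂) / 2 + (x₀ + x₃) / 6))
      - 2 * (c₀ * c₃ * (σ₁ * σ₂ * d₁₂) - d₁₂ + d₁₂ * ((x₀ + x₃) / 2 + (x₁ + x₂) / 6))
      - 2 * (c₀ * c₂ * (σ₁ * σ₃ * d₁₃) - d₁₃ + d₁₃ * ((x₀ + x₂) / 2 + (x₁ + x₃) / 6))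
      - 2 * (σ₀ * σ₁ * d₀₁ * (σ₂ * σ₃ * d₂₃) - d₀₁ * d₂₃) + 2 * (σ₀ * σ₂ * d₀₂ * (σ₁ * σ₃ * d₁₃) - d₀₂ * d₁₃)
      - 2 * (σ₀ * σ₃ * d₀₃ * (σ₁ * σ₂ * d₁₂) - d₀₃ * d₁₂) := by ring
  rw [hid, abs_le]
  constructor
  · linarith [(abs_le.1 hD).1, (abs_le.1 P01).1, (abs_le.1 P23).1, (abs_le.1 P02).2, (abs_le.1 P03).2, (abs_le.1 P12).2,
      (abs_le.1 P13).2, (abs_le.1 Q1).2, (abs_le.1 Q2).1, (abs_le.1 Q3).2]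
  · linarith [(abs_le.1 hD).2, (abs_le.1 P01).2, (abs_le.1 P23).2, (abs_le.1 P02).1, (abs_le.1 P03).1, (abs_le.1 P12).1,
      (abs_le.1 P13).1, (abs_le.1 Q1).1, (abs_le.1 Q2).2, (abs_le.1 Q3).1]


end WilsonTaylor

end Summit.QuantumFields.YangMills.Theorems.AllWindowsColdBoxBoxHighLine

end
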